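import Summits.BirchSwinnertonDyer.BirchSwinnertonDyer.Theorems.Rank2ObservatoryRank3SatCert
import Summits.BirchSwinnertonDyer.BirchSwinnertonDyer.Theorems.Rank2ObservatoryRank3WitnessT
import HarnessLib

/-!
# BirchSwinnertonDyer — rank ≥ 2 observatory: rank-3 saturation certificates, torsion variant T

HONEST FRAMING: per-curve certified theorems and census instruments; no claim on BSD in rank ≥ 2.

The base row Boolean `rank3SatCheck` (`Rank2ObservatoryRank3SatCert.lean`) kills `E(ℚ)_tors` by
the annihilator `t = 2^u · m` read off kernel point counts and runs the seven coset tests with that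
`u`.  Point counts are isogeny invariants, so for 66 rows of the census table the counts only give
`t = 4` although `E(ℚ)[2^∞]` has exponent `2`; the kernel certificate of record for those rows
(`Rank2ObservatoryRank3WitnessT.lean`, files `…Rank3KernelCertsT*`) lowers the `2`-exponent to
`u = 1` with ONE good odd prime `ℓ₀` at which `Ẽ(𝔽_{ℓ₀})` has no element of order `4`
(`noOrder4`, `torsion_zsmul_eq_zero_of_noOrder4`).  This file is the same sharpening for the
SATURATION instrument:

* `twoSaturated_of_certB'` — the core of `twoSaturated_of_certB` with the torsion input
  `2^u · m · E(ℚ)_tors = 0` supplied as a hypothesis (any source);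
* `twoSaturated_of_certT` — torsion input from `t = 2^e · m` (`annihilatorCheck`) and
  `noOrder4B V ℓ₀` (`Rank2ObservatoryKernelWalker`), coset tests with `u = 1`;
* `Rank3Row.twoSaturated_of_scaled` — the TRANSPORT step of `Rank3Row.twoSaturated_of_satCheck`
  as a standalone theorem: `2`-saturation and independence of integral points `(Xᵢ, Yᵢ)` on the
  scaled model `scaleModel r.intModel d` with `Xᵢ·Zᵢ = d²·xᵢ`, `Yᵢ·Zᵢ = d³·yᵢ` give the same for
  the listed generators `r.genᵢ` in `E(ℚ) = r.curve⟮ℚ⟯` (change of variables `(x,y) ↦ (d²x,d³y)`);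
* `Rank3SatCertT`, `rank3SatCheckT`, `Rank3Row.twoSaturated_of_satCheckT`, `rank3SatCheckTAll`,
  `Rank3Row.twoSaturated_of_satCheckTAll` — the row Boolean (kernel `decide`) and its soundness,
  with the SAME conclusion as the base instrument, so the census covers treat both alike.

References: Cremona, *Algorithms for Modular Elliptic Curves* (1997) §3.5; Siksek, Rocky Mountain
J. Math. 25 (1995); Silverman, *The Arithmetic of Elliptic Curves* (2009) VII.3.1(b), VIII.6.7.
-/

-- single-conjunct summit: `Summit.BirchSwinnertonDyer.BirchSwinnertonDyer.…` repeats the name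
set_option linter.dupNamespace false

open WeierstrassCurve

namespace Summit.BirchSwinnertonDyer.BirchSwinnertonDyer.Rank2Observatory

/-! ### The core with the torsion input as a hypothesis -/

/-- **Core of the saturation certificate**: `m` odd, `2^u · m` kills `E(ℚ)_tors` (hypothesis),
and the seven coset witnesses with exponent `u` give a `2`-saturated listed span and
`ℤ`-independent points. [cite: CremonaAlgorithms1997, §3.5] -/
theorem twoSaturated_of_certB' (V : WeierstrassCurve ℤ) (hΔ : V.Δ ≠ 0) {X₁ Y₁ X₂ Y₂ X₃ Y₃ : ℤ}
    (e₁ : Y₁ ^ 2 + V.a₁ * X₁ * Y₁ + V.a₃ * Y₁ = X₁ ^ 3 + V.a₂ * X₁ ^ 2 + V.a₄ * X₁ + V.a₆)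
    (e₂ : Y₂ ^ 2 + V.a₁ * X₂ * Y₂ + V.a₃ * Y₂ = X₂ ^ 3 + V.a₂ * X₂ ^ 2 + V.a₄ * X₂ + V.a₆)
    (e₃ : Y₃ ^ 2 + V.a₁ * X₃ * Y₃ + V.a₃ * Y₃ = X₃ ^ 3 + V.a₂ * X₃ ^ 2 + V.a₄ * X₃ + V.a₆)
    {u m : ℕ} (hm : m % 2 = 1)
    (htors : ∀ x : (V.map (Int.castRingHom ℚ)).toAffine.Point, IsOfFinAddOrder x →
      ((2 : ℤ) ^ u * (m : ℤ)) • x = 0)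
    {q₁ q₂ q₃ q₁₂ q₁₃ q₂₃ q₁₂₃ : ℕ} {X₁₂ Y₁₂ X₁₃ Y₁₃ X₂₃ Y₂₃ X₀ Y₀ X₁₂₃ Y₁₂₃ : ℤ}
    (hw₁ : witnessB V u q₁ X₁ Y₁ = true) (hw₂ : witnessB V u q₂ X₂ Y₂ = true)
    (hw₃ : witnessB V u q₃ X₃ Y₃ = true)
    (hw₁₂ : witness₂B V u q₁₂ X₁ Y₁ X₂ Y₂ X₁₂ Y₁₂ = true)
    (hw₁₃ : witness₂B V u q₁₃ X₁ Y₁ X₃ Y₃ X₁₃ Y₁₃ = true)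
    (hw₂₃ : witness₂B V u q₂₃ X₂ Y₂ X₃ Y₃ X₂₃ Y₂₃ = true)
    (hw₁₂₃ : witness₃B V u q₁₂₃ X₁ Y₁ X₂ Y₂ X₀ Y₀ X₃ Y₃ X₁₂₃ Y₁₂₃ = true) :
    (∀ a : (V.map (Int.castRingHom ℚ)).toAffine.Point,
      2 • a ∈ AddSubgroup.closure
          {Affine.Point.some (X₁ : ℚ) (Y₁ : ℚ) (nonsingular_rat_of_eq V hΔ e₁),
            Affine.Point.some (X₂ : ℚ) (Y₂ : ℚ) (nonsingular_rat_of_eq V hΔ e₂),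
            Affine.Point.some (X₃ : ℚ) (Y₃ : ℚ) (nonsingular_rat_of_eq V hΔ e₃)} ⊔
          AddCommGroup.torsion _ →
      a ∈ AddSubgroup.closure
          {Affine.Point.some (X₁ : ℚ) (Y₁ : ℚ) (nonsingular_rat_of_eq V hΔ e₁),
            Affine.Point.some (X₂ : ℚ) (Y₂ : ℚ) (nonsingular_rat_of_eq V hΔ e₂),
            Affine.Point.some (X₃ : ℚ) (Y₃ : ℚ) (nonsingular_rat_of_eq V hΔ e₃)} ⊔
          AddCommGroup.torsion _) ∧
    LinearIndependent ℤ
      ![(Affine.Point.some (X₁ : ℚ) (Y₁ : ℚ) (nonsingular_rat_of_eq V hΔ e₁) :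
          (V.map (Int.castRingHom ℚ)).toAffine.Point),
        Affine.Point.some (X₂ : ℚ) (Y₂ : ℚ) (nonsingular_rat_of_eq V hΔ e₂),
        Affine.Point.some (X₃ : ℚ) (Y₃ : ℚ) (nonsingular_rat_of_eq V hΔ e₃)] := by
  classical
  have hm' : Odd (m : ℤ) := by exact_mod_cast Nat.odd_iff.mpr hm
  have E₁ : V.toAffine.Equation X₁ Y₁ := (Affine.equation_iff X₁ Y₁).mpr e₁
  have E₂ : V.toAffine.Equation X₂ Y₂ := (Affine.equation_iff X₂ Y₂).mpr e₂
  have E₃ : V.toAffine.Equation X₃ Y₃ := (Affine.equation_iff X₃ Y₃).mpr e₃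
  have h₁ := not_mem_twoCoset_of_witnessB hw₁ E₁ (nonsingular_rat_of_eq V hΔ e₁)
  have h₂ := not_mem_twoCoset_of_witnessB hw₂ E₂ (nonsingular_rat_of_eq V hΔ e₂)
  have h₃ := not_mem_twoCoset_of_witnessB hw₃ E₃ (nonsingular_rat_of_eq V hΔ e₃)
  have h₁₂ := not_mem_twoCoset_of_witness₂B hw₁₂ E₁ E₂ (nonsingular_rat_of_eq V hΔ e₁)
    (nonsingular_rat_of_eq V hΔ e₂)
  have h₁₃ := not_mem_twoCoset_of_witness₂B hw₁₃ E₁ E₃ (nonsingular_rat_of_eq V hΔ e₁)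
    (nonsingular_rat_of_eq V hΔ e₃)
  have h₂₃ := not_mem_twoCoset_of_witness₂B hw₂₃ E₂ E₃ (nonsingular_rat_of_eq V hΔ e₂)
    (nonsingular_rat_of_eq V hΔ e₃)
  have h₁₂₃ := not_mem_twoCoset_of_witness₃B hw₁₂₃ E₁ E₂ E₃ (nonsingular_rat_of_eq V hΔ e₁)
    (nonsingular_rat_of_eq V hΔ e₂) (nonsingular_rat_of_eq V hΔ e₃)
  exact ⟨listedSpan_two_saturated_of_not_mem_twoCoset hm' htors h₁ h₂ h₃ h₁₂ h₁₃ h₂₃ h₁₂₃,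
    linearIndependent_triple_of_not_mem_twoCoset hm' htors h₁ h₂ h₃ h₁₂ h₁₃ h₂₃ h₁₂₃⟩

/-- **Variant T**: torsion annihilator `t = 2^e · m` from the counts (`m` odd, any `e`), one good
odd prime `ℓ₀` with `noOrder4B V ℓ₀` (so `2m · E(ℚ)_tors = 0`), coset tests with `u = 1`.
[cite: CremonaAlgorithms1997, §3.5] [cite: SilvermanAEC2009, Prop. VII.3.1(b)] -/
theorem twoSaturated_of_certT (V : WeierstrassCurve ℤ) (hΔ : V.Δ ≠ 0) {X₁ Y₁ X₂ Y₂ X₃ Y₃ : ℤ}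
    (e₁ : Y₁ ^ 2 + V.a₁ * X₁ * Y₁ + V.a₃ * Y₁ = X₁ ^ 3 + V.a₂ * X₁ ^ 2 + V.a₄ * X₁ + V.a₆)
    (e₂ : Y₂ ^ 2 + V.a₁ * X₂ * Y₂ + V.a₃ * Y₂ = X₂ ^ 3 + V.a₂ * X₂ ^ 2 + V.a₄ * X₂ + V.a₆)
    (e₃ : Y₃ ^ 2 + V.a₁ * X₃ * Y₃ + V.a₃ * Y₃ = X₃ ^ 3 + V.a₂ * X₃ ^ 2 + V.a₄ * X₃ + V.a₆)
    {S : List (ℕ × ℕ)} {t e m : ℕ} (hm : m % 2 = 1) (hte : t = 2 ^ e * m)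
    (hann : annihilatorCheck S t = true) (hS : S.all (killerB V) = true) {ℓ₀ : ℕ}
    (h4 : noOrder4B V ℓ₀ = true)
    {q₁ q₂ q₃ q₁₂ q₁₃ q₂₃ q₁₂₃ : ℕ} {X₁₂ Y₁₂ X₁₃ Y₁₃ X₂₃ Y₂₃ X₀ Y₀ X₁₂₃ Y₁₂₃ : ℤ}
    (hw₁ : witnessB V 1 q₁ X₁ Y₁ = true) (hw₂ : witnessB V 1 q₂ X₂ Y₂ = true)
    (hw₃ : witnessB V 1 q₃ X₃ Y₃ = true)
    (hw₁₂ : witness₂B V 1 q₁₂ X₁ Y₁ X₂ Y₂ X₁₂ Y₁₂ = true)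
    (hw₁₃ : witness₂B V 1 q₁₃ X₁ Y₁ X₃ Y₃ X₁₃ Y₁₃ = true)
    (hw₂₃ : witness₂B V 1 q₂₃ X₂ Y₂ X₃ Y₃ X₂₃ Y₂₃ = true)
    (hw₁₂₃ : witness₃B V 1 q₁₂₃ X₁ Y₁ X₂ Y₂ X₀ Y₀ X₃ Y₃ X₁₂₃ Y₁₂₃ = true) :
    (∀ a : (V.map (Int.castRingHom ℚ)).toAffine.Point,
      2 • a ∈ AddSubgroup.closure
          {Affine.Point.some (X₁ : ℚ) (Y₁ : ℚ) (nonsingular_rat_of_eq V hΔ e₁),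
            Affine.Point.some (X₂ : ℚ) (Y₂ : ℚ) (nonsingular_rat_of_eq V hΔ e₂),
            Affine.Point.some (X₃ : ℚ) (Y₃ : ℚ) (nonsingular_rat_of_eq V hΔ e₃)} ⊔
          AddCommGroup.torsion _ →
      a ∈ AddSubgroup.closure
          {Affine.Point.some (X₁ : ℚ) (Y₁ : ℚ) (nonsingular_rat_of_eq V hΔ e₁),
            Affine.Point.some (X₂ : ℚ) (Y₂ : ℚ) (nonsingular_rat_of_eq V hΔ e₂),
            Affine.Point.some (X₃ : ℚ) (Y₃ : ℚ) (nonsingular_rat_of_eq V hΔ e₃)} ⊔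
          AddCommGroup.torsion _) ∧
    LinearIndependent ℤ
      ![(Affine.Point.some (X₁ : ℚ) (Y₁ : ℚ) (nonsingular_rat_of_eq V hΔ e₁) :
          (V.map (Int.castRingHom ℚ)).toAffine.Point),
        Affine.Point.some (X₂ : ℚ) (Y₂ : ℚ) (nonsingular_rat_of_eq V hΔ e₂),
        Affine.Point.some (X₃ : ℚ) (Y₃ : ℚ) (nonsingular_rat_of_eq V hΔ e₃)] := by
  cases ℓ₀ with
  | zero => simp [noOrder4B] at h4
  | succ ℓ =>
  simp only [noOrder4B, goodPrimeB, Bool.and_eq_true, decide_eq_true_eq] at h4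
  haveI : Fact (ℓ + 1).Prime := ⟨h4.1.1.1⟩
  have htors : ∀ x : (V.map (Int.castRingHom ℚ)).toAffine.Point, IsOfFinAddOrder x →
      ((2 : ℤ) ^ 1 * (m : ℤ)) • x = 0 := fun x hx =>
    torsion_zsmul_eq_zero_of_noOrder4 V hte (killers_of_all_killerB V hS) hann (ℓ + 1) h4.1.1.2
      h4.1.2 h4.2 x hx
  exact twoSaturated_of_certB' V hΔ e₁ e₂ e₃ hm htors hw₁ hw₂ hw₃ hw₁₂ hw₁₃ hw₂₃ hw₁₂₃

/-! ### Transport from the scaled model to the census equation -/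

section Transport

/-- Transport of `Point.some` along equal coordinates. [folklore] -/
private theorem some_eq_some {W : Affine ℚ} {x y x' y' : ℚ} (hx : x = x') (hy : y = y')
    {h : W.Nonsingular x y} {h' : W.Nonsingular x' y'} :
    Affine.Point.some x y h = .some x' y' h' := by
  subst hx hy
  rfl

/-- The scaled coordinate: `X'·Z = dᵏ·X` gives `dᵏ · (X/Z) = X'` over `ℚ`. [folklore] -/
private theorem scaled_coord {X' Z X d : ℤ} (k : ℕ) (hZ : Z ≠ 0) (h : X' * Z = d ^ k * X) :
    (d : ℚ) ^ k * ((X : ℚ) / Z) = X' := by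
  have hZ' : (Z : ℚ) ≠ 0 := by exact_mod_cast hZ
  rw [← mul_div_assoc, div_eq_iff hZ']
  exact_mod_cast h.symm

end Transport

namespace Rank3Row

/-- **TRANSPORT.** `2`-saturation of the listed span and independence of integral points
`(Xᵢ, Yᵢ)` on the scaled model `V = scaleModel r.intModel d` (`d ≠ 0`) whose coordinates are
the listed generators' scaled by `(d², d³)` give the same statements for `r.gen₁, r.gen₂, r.gen₃`
in `E(ℚ) = r.curve⟮ℚ⟯`, along `E(ℚ) ≃+ V⟮ℚ⟯` (`VariableChange.pointEquiv`,
`map_scaleModel_eq_smul`, `Affine.Point.congrEquiv`; `two_saturated_map`,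
`linearIndependent_triple_map`). [cite: SilvermanAEC2009, III.3.1(b)] -/
theorem twoSaturated_of_scaled (r : Rank3Row) (h : r.check = true) {d : ℤ} (hd : d ≠ 0)
    {X₁ Y₁ X₂ Y₂ X₃ Y₃ : ℤ}
    (hX₁ : X₁ * r.P₁.2.2 = d ^ 2 * r.P₁.1) (hY₁ : Y₁ * r.P₁.2.2 = d ^ 3 * r.P₁.2.1)
    (hX₂ : X₂ * r.P₂.2.2 = d ^ 2 * r.P₂.1) (hY₂ : Y₂ * r.P₂.2.2 = d ^ 3 * r.P₂.2.1)
    (hX₃ : X₃ * r.P₃.2.2 = d ^ 2 * r.P₃.1) (hY₃ : Y₃ * r.P₃.2.2 = d ^ 3 * r.P₃.2.1)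
    (hΔ : (scaleModel r.intModel d).Δ ≠ 0)
    (e₁ : Y₁ ^ 2 + (scaleModel r.intModel d).a₁ * X₁ * Y₁ + (scaleModel r.intModel d).a₃ * Y₁ =
      X₁ ^ 3 + (scaleModel r.intModel d).a₂ * X₁ ^ 2 + (scaleModel r.intModel d).a₄ * X₁ +
        (scaleModel r.intModel d).a₆)
    (e₂ : Y₂ ^ 2 + (scaleModel r.intModel d).a₁ * X₂ * Y₂ + (scaleModel r.intModel d).a₃ * Y₂ =
      X₂ ^ 3 + (scaleModel r.intModel d).a₂ * X₂ ^ 2 + (scaleModel r.intModel d).a₄ * X₂ +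
        (scaleModel r.intModel d).a₆)
    (e₃ : Y₃ ^ 2 + (scaleModel r.intModel d).a₁ * X₃ * Y₃ + (scaleModel r.intModel d).a₃ * Y₃ =
      X₃ ^ 3 + (scaleModel r.intModel d).a₂ * X₃ ^ 2 + (scaleModel r.intModel d).a₄ * X₃ +
        (scaleModel r.intModel d).a₆)
    (H : (∀ a : ((scaleModel r.intModel d).map (Int.castRingHom ℚ)).toAffine.Point,
      2 • a ∈ AddSubgroup.closure
          {Affine.Point.some (X₁ : ℚ) (Y₁ : ℚ) (nonsingular_rat_of_eq _ hΔ e₁),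
            Affine.Point.some (X₂ : ℚ) (Y₂ : ℚ) (nonsingular_rat_of_eq _ hΔ e₂),
            Affine.Point.some (X₃ : ℚ) (Y₃ : ℚ) (nonsingular_rat_of_eq _ hΔ e₃)} ⊔
          AddCommGroup.torsion _ →
      a ∈ AddSubgroup.closure
          {Affine.Point.some (X₁ : ℚ) (Y₁ : ℚ) (nonsingular_rat_of_eq _ hΔ e₁),
            Affine.Point.some (X₂ : ℚ) (Y₂ : ℚ) (nonsingular_rat_of_eq _ hΔ e₂),
            Affine.Point.some (X₃ : ℚ) (Y₃ : ℚ) (nonsingular_rat_of_eq _ hΔ e₃)} ⊔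
          AddCommGroup.torsion _) ∧
    LinearIndependent ℤ
      ![(Affine.Point.some (X₁ : ℚ) (Y₁ : ℚ) (nonsingular_rat_of_eq _ hΔ e₁) :
          ((scaleModel r.intModel d).map (Int.castRingHom ℚ)).toAffine.Point),
        Affine.Point.some (X₂ : ℚ) (Y₂ : ℚ) (nonsingular_rat_of_eq _ hΔ e₂),
        Affine.Point.some (X₃ : ℚ) (Y₃ : ℚ) (nonsingular_rat_of_eq _ hΔ e₃)]) :
    (∀ a : r.curve.toAffine.Point,
      2 • a ∈ AddSubgroup.closure {r.gen₁ h, r.gen₂ h, r.gen₃ h} ⊔ AddCommGroup.torsion _ →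
        a ∈ AddSubgroup.closure {r.gen₁ h, r.gen₂ h, r.gen₃ h} ⊔ AddCommGroup.torsion _) ∧
    LinearIndependent ℤ ![r.gen₁ h, r.gen₂ h, r.gen₃ h] := by
  classical
  obtain ⟨hsat, hli⟩ := H
  have hd' : (d : ℚ) ≠ 0 := by exact_mod_cast hd
  let C : VariableChange ℚ := ⟨(Units.mk0 (d : ℚ) hd')⁻¹, 0, 0, 0⟩
  have hVC : C • r.curve = (scaleModel r.intModel d).map (Int.castRingHom ℚ) := by
    rw [r.curve_eq_map_intModel]
    exact (map_scaleModel_eq_smul r.intModel hd).symm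
  let e : r.curve.toAffine.Point ≃+
      ((scaleModel r.intModel d).map (Int.castRingHom ℚ)).toAffine.Point :=
    (VariableChange.pointEquiv r.curve C).trans (Affine.Point.congrEquiv hVC)
  have hCx : ∀ x : ℚ, C.toX x = (d : ℚ) ^ 2 * x := by
    intro x
    simp only [VariableChange.toX_def, C, inv_inv, Units.val_mk0, sub_zero]
  have hCy : ∀ x y : ℚ, C.toY x y = (d : ℚ) ^ 3 * y := by
    intro x y
    simp only [VariableChange.toY_def, C, inv_inv, Units.val_mk0, sub_zero, zero_mul]
  obtain ⟨-, hP₁, hP₂, hP₃, -⟩ := r.check_spec h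
  have hZ₁ : r.P₁.2.2 ≠ 0 := (of_decide_eq_true hP₁).1
  have hZ₂ : r.P₂.2.2 ≠ 0 := (of_decide_eq_true hP₂).1
  have hZ₃ : r.P₃.2.2 ≠ 0 := (of_decide_eq_true hP₃).1
  have eg₁ : e (r.gen₁ h) = .some (X₁ : ℚ) (Y₁ : ℚ) (nonsingular_rat_of_eq _ hΔ e₁) := by
    simp only [e, AddEquiv.trans_apply, Rank3Row.gen₁, VariableChange.pointEquiv_some,
      Affine.Point.congrEquiv_some]
    exact some_eq_some (by rw [hCx]; exact scaled_coord 2 hZ₁ hX₁)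
      (by rw [hCy]; exact scaled_coord 3 hZ₁ hY₁)
  have eg₂ : e (r.gen₂ h) = .some (X₂ : ℚ) (Y₂ : ℚ) (nonsingular_rat_of_eq _ hΔ e₂) := by
    simp only [e, AddEquiv.trans_apply, Rank3Row.gen₂, VariableChange.pointEquiv_some,
      Affine.Point.congrEquiv_some]
    exact some_eq_some (by rw [hCx]; exact scaled_coord 2 hZ₂ hX₂)
      (by rw [hCy]; exact scaled_coord 3 hZ₂ hY₂)
  have eg₃ : e (r.gen₃ h) = .some (X₃ : ℚ) (Y₃ : ℚ) (nonsingular_rat_of_eq _ hΔ e₃) := by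
    simp only [e, AddEquiv.trans_apply, Rank3Row.gen₃, VariableChange.pointEquiv_some,
      Affine.Point.congrEquiv_some]
    exact some_eq_some (by rw [hCx]; exact scaled_coord 2 hZ₃ hX₃)
      (by rw [hCy]; exact scaled_coord 3 hZ₃ hY₃)
  have es₁ : e.symm (.some (X₁ : ℚ) (Y₁ : ℚ) (nonsingular_rat_of_eq _ hΔ e₁)) = r.gen₁ h := by
    rw [← eg₁, AddEquiv.symm_apply_apply]
  have es₂ : e.symm (.some (X₂ : ℚ) (Y₂ : ℚ) (nonsingular_rat_of_eq _ hΔ e₂)) = r.gen₂ h := by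
    rw [← eg₂, AddEquiv.symm_apply_apply]
  have es₃ : e.symm (.some (X₃ : ℚ) (Y₃ : ℚ) (nonsingular_rat_of_eq _ hΔ e₃)) = r.gen₃ h := by
    rw [← eg₃, AddEquiv.symm_apply_apply]
  have hsat' := two_saturated_map e.symm hsat
  have hli' := linearIndependent_triple_map e.symm hli
  rw [es₁, es₂, es₃] at hsat' hli'
  exact ⟨hsat', hli'⟩

end Rank3Row

/-! ### The row certificate, variant T -/

/-- Certificate DATA, variant T: a base certificate `c` (its field `u` must be `1`; the coset
tests are run with `u = 1`), the `2`-exponent `e` of the count annihilator (`c.t = 2^e · c.m`)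
and the good odd prime `ℓ₀` with no element of order `4` in `Ẽ(𝔽_{ℓ₀})`.
[cite: CremonaAlgorithms1997, §3.5] -/
structure Rank3SatCertT where
  /-- the base certificate (points, killers, `t`, `u = 1`, `m`, witness primes, chords) -/
  c : Rank3SatCert
  /-- `c.t = 2^e · c.m` -/
  e : ℕ
  /-- good odd prime with `noOrder4` -/
  ℓ₀ : ℕ

/-- **The row Boolean, variant T** (kernel `decide`): as `rank3SatCheck` but the torsion clause is
`c.t = 2^e · m ∧ u = 1 ∧ noOrder4B V ℓ₀`, and the seven witnesses use exponent `1`.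
[cite: CremonaAlgorithms1997, §3.5] -/
def rank3SatCheckT (r : Rank3Row) (w : Rank3SatCertT) : Bool :=
  let c := w.c
  let V := scaleModel r.intModel c.d
  decide (c.d ≠ 0 ∧ c.m % 2 = 1 ∧ c.t = 2 ^ w.e * c.m ∧ c.u = 1 ∧
      c.X₁ * r.P₁.2.2 = c.d ^ 2 * r.P₁.1 ∧ c.Y₁ * r.P₁.2.2 = c.d ^ 3 * r.P₁.2.1 ∧
      c.X₂ * r.P₂.2.2 = c.d ^ 2 * r.P₂.1 ∧ c.Y₂ * r.P₂.2.2 = c.d ^ 3 * r.P₂.2.1 ∧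
      c.X₃ * r.P₃.2.2 = c.d ^ 2 * r.P₃.1 ∧ c.Y₃ * r.P₃.2.2 = c.d ^ 3 * r.P₃.2.1 ∧
      c.Y₁ ^ 2 + V.a₁ * c.X₁ * c.Y₁ + V.a₃ * c.Y₁ =
        c.X₁ ^ 3 + V.a₂ * c.X₁ ^ 2 + V.a₄ * c.X₁ + V.a₆ ∧
      c.Y₂ ^ 2 + V.a₁ * c.X₂ * c.Y₂ + V.a₃ * c.Y₂ =
        c.X₂ ^ 3 + V.a₂ * c.X₂ ^ 2 + V.a₄ * c.X₂ + V.a₆ ∧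
      c.Y₃ ^ 2 + V.a₁ * c.X₃ * c.Y₃ + V.a₃ * c.Y₃ =
        c.X₃ ^ 3 + V.a₂ * c.X₃ ^ 2 + V.a₄ * c.X₃ + V.a₆) &&
  annihilatorCheck c.S c.t && c.S.all (killerB V) && noOrder4B V w.ℓ₀ &&
  witnessB V 1 c.q₁ c.X₁ c.Y₁ && witnessB V 1 c.q₂ c.X₂ c.Y₂ &&
  witnessB V 1 c.q₃ c.X₃ c.Y₃ &&
  witness₂B V 1 c.q₁₂ c.X₁ c.Y₁ c.X₂ c.Y₂ c.X₁₂ c.Y₁₂ &&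
  witness₂B V 1 c.q₁₃ c.X₁ c.Y₁ c.X₃ c.Y₃ c.X₁₃ c.Y₁₃ &&
  witness₂B V 1 c.q₂₃ c.X₂ c.Y₂ c.X₃ c.Y₃ c.X₂₃ c.Y₂₃ &&
  witness₃B V 1 c.q₁₂₃ c.X₁ c.Y₁ c.X₂ c.Y₂ c.X₀ c.Y₀ c.X₃ c.Y₃ c.X₁₂₃ c.Y₁₂₃

/-- **SOUNDNESS of the row certificate, variant T**: same conclusion as
`Rank3Row.twoSaturated_of_satCheck`. [cite: CremonaAlgorithms1997, §3.5]
[cite: SilvermanAEC2009, Prop. VII.3.1(b)] -/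
theorem Rank3Row.twoSaturated_of_satCheckT (r : Rank3Row) (h : r.check = true)
    (w : Rank3SatCertT) (hc : rank3SatCheckT r w = true) :
    (∀ a : r.curve.toAffine.Point,
      2 • a ∈ AddSubgroup.closure {r.gen₁ h, r.gen₂ h, r.gen₃ h} ⊔ AddCommGroup.torsion _ →
        a ∈ AddSubgroup.closure {r.gen₁ h, r.gen₂ h, r.gen₃ h} ⊔ AddCommGroup.torsion _) ∧
    LinearIndependent ℤ ![r.gen₁ h, r.gen₂ h, r.gen₃ h] := by
  simp only [rank3SatCheckT, Bool.and_eq_true, decide_eq_true_eq] at hc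
  obtain ⟨⟨⟨⟨⟨⟨⟨⟨⟨⟨⟨hd, hm, hte, -, hX₁, hY₁, hX₂, hY₂, hX₃, hY₃, e₁, e₂, e₃⟩, hann⟩, hS⟩, h4⟩,
    hw₁⟩, hw₂⟩, hw₃⟩, hw₁₂⟩, hw₁₃⟩, hw₂₃⟩, hw₁₂₃⟩ := hc
  have hΔ : (scaleModel r.intModel w.c.d).Δ ≠ 0 := Δ_ne_zero_of_witnessB hw₁
  exact r.twoSaturated_of_scaled h hd hX₁ hY₁ hX₂ hY₂ hX₃ hY₃ hΔ e₁ e₂ e₃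
    (twoSaturated_of_certT _ hΔ e₁ e₂ e₃ hm hte hann hS h4 hw₁ hw₂ hw₃ hw₁₂ hw₁₃ hw₂₃ hw₁₂₃)

/-- The variant-T Boolean over a list of rows and certificates (same order). [folklore] -/
def rank3SatCheckTAll : List Rank3Row → List Rank3SatCertT → Bool
  | [], _ => true
  | _ :: _, [] => false
  | r :: rs, w :: ws => rank3SatCheckT r w && rank3SatCheckTAll rs ws

/-- **Soundness of the list form, variant T.** [cite: CremonaAlgorithms1997, §3.5] -/
theorem Rank3Row.twoSaturated_of_satCheckTAll :
    ∀ {rows : List Rank3Row} {ws : List Rank3SatCertT}, rank3SatCheckTAll rows ws = true →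
      ∀ r ∈ rows, ∀ h : r.check = true,
        (∀ a : r.curve.toAffine.Point,
          2 • a ∈ AddSubgroup.closure {r.gen₁ h, r.gen₂ h, r.gen₃ h} ⊔ AddCommGroup.torsion _ →
            a ∈ AddSubgroup.closure {r.gen₁ h, r.gen₂ h, r.gen₃ h} ⊔ AddCommGroup.torsion _) ∧
        LinearIndependent ℤ ![r.gen₁ h, r.gen₂ h, r.gen₃ h]
  | [], _, _ => by simp
  | _ :: _, [], h => by simp [rank3SatCheckTAll] at h
  | r :: rs, w :: ws, h => by
    rw [rank3SatCheckTAll, Bool.and_eq_true] at h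
    intro r' hr' h'
    rcases List.mem_cons.mp hr' with rfl | hr'
    · exact r'.twoSaturated_of_satCheckT h' w h.1
    · exact Rank3Row.twoSaturated_of_satCheckTAll h.2 r' hr' h'

end Summit.BirchSwinnertonDyer.BirchSwinnertonDyer.Rank2Observatory
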